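import Summits.QuantumFields.BalabanUV.Beta.GAN24.DirichletRingEnergies

/-!
# `BalabanUV.Beta.GAN24.DirichletRingHessianIdentity` — binder row G-an2-4 / (CONV-C), road P2 PART IV, leaf L10 in MODEL coordinates: THE
# DISCRETE `H²` INEQUALITY `Σ_{x∉Q}(|∂₁²z|² + |∂₂²z|²) ≤ Σ_{x∉Q}|Δz|²` FOR A FINITELY SUPPORTED LATTICE FUNCTION VANISHING ON THE QUADRANT `Q` AND AT
# THE RE-ENTRANT VERTEX (unit b2b-balaban-gan24-p2, gen 25, v1)

HONEST FRAMING (cell contract, verbatim): «discharging `BetaPertH` makes Bałaban's UV stability UNCONDITIONAL — a real constructive-QFT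
result; it is NOT the continuum limit and NOT the Clay problem.»  Model-coordinate version of leaf L10 (the tree's torus statement is
`DirichletBoxRegularityLocal.hdiag_le_sum_normSq_LapS_local`, p235560) for the programme of memo `HOME/b2b-balaban-gan24-p2/gen24/W-FULL-WEIGHTED.md`
§3, step (A) near a re-entrant vertex: a function `z : ℤ → ℤ → ℂ` supported well inside a lattice box `[a, a+L)²`, the diagonal second
differences `d1 z (i,j) = z(i+1,j) − 2z(i,j) + z(i−1,j)`, `d2` likewise, the 5-point Laplacian `lap z = −(d1 z + d2 z)` of `DirichletRingEnergies`:
 * §1 `sum_shift`/`box_shift₁`/`box_shift₂` — shifting a box sum by one lattice unit when the summand vanishes on the boundary layers;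
 * §2 **`box_cross_eq`** — `Σ_box conj(d1 z)·(d2 z) = Σ_box |m z|²` with the mixed difference `m z (i,j) = z(i+1,j+1) − z(i+1,j) − z(i,j+1) + z(i,j)`
   (two summations by parts), hence **`box_hessian_le`** — `Σ_box (|d1 z|² + |d2 z|²) ≤ Σ_box |lap z|²`;
 * §3 **`hessian_le_offQuadrant`** — if moreover `z = 0` on the quadrant `Q = {0 ≤ i} × {0 ≤ j}` and `z(−1,0) = 0` (the cut-off kills the
   vertex), then `Σ_{box∖Q}(|d1 z|² + |d2 z|²) ≤ Σ_{box∖Q}|lap z|²` — because at a quadrant site both sides reduce to the same boundary value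
   (the only cross term sits at the vertex `(0,0)` and is `2Re(z̄(−1,0)z(0,−1)) = 0`).
Consumer: the dyadic (A)-assembly (leaf L12, model) with `z = χ·U`, `χ` a ring cut-off vanishing near the vertex.

ABSOLUTE RULE (cell, verbatim): «No internally-minted statement may enter as a cited fact. Every hypothesis is either kernel-proved in
this package or a verbatim quotation of a PUBLISHED theorem with page reference. The manuscript(s) under audit are NOT citable for
their own disputed steps — they are the thing under adjudication; programme-internal (2001/route/tribunal) claims are never citable.»
[folklore] finite lattice calculus; nothing printed is a hypothesis.  NOT CLAIMED: (A)/(B) on the torus, NE2, (CONV-C), `BetaPertH`, continuum,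
Clay.  «not in print; our proof attempt».  HONEST DEPENDENCY: continuum YM on T⁴ ⇐ BetaPertH ∧ nine spine estimates (0/9 proved); BetaPertH ⇐
(D1) ∧ (D4) ∧ CAP+tail; G-an2-4 gates asym, D1 and NE2/3/4.
-/

noncomputable section

open scoped BigOperators ComplexConjugate
open Finset

namespace Summit.QuantumFields.BalabanUV.Beta.GAN24.DirichletRingHessianIdentity

open DirichletRingEnergies (lap)

variable (z : ℤ → ℤ → ℂ)

/-! ## §1 Second differences, box sums and shifts -/

/-- the horizontal second difference `z(i+1,j) − 2z(i,j) + z(i−1,j)`. [folklore] -/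
def d1 (i j : ℤ) : ℂ := z (i + 1) j - 2 * z i j + z (i - 1) j

/-- the vertical second difference `z(i,j+1) − 2z(i,j) + z(i,j−1)`. [folklore] -/
def d2 (i j : ℤ) : ℂ := z i (j + 1) - 2 * z i j + z i (j - 1)

/-- the mixed forward difference `z(i+1,j+1) − z(i+1,j) − z(i,j+1) + z(i,j)`. [folklore] -/
def dmix (i j : ℤ) : ℂ := z (i + 1) (j + 1) - z (i + 1) j - z i (j + 1) + z i j

/-- `Δz = −(∂₁²z + ∂₂²z)`. [folklore] -/
theorem lap_eq_neg (i j : ℤ) : lap z i j = -(d1 z i j + d2 z i j) := by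
  rw [lap, d1, d2]; ring

/-- the box sum `Σ_{t<L} Σ_{s<L} F(a+s, a+t)`. [folklore] -/
def boxSum {M : Type*} [AddCommMonoid M] (F : ℤ → ℤ → M) (a : ℤ) (L : ℕ) : M :=
  ∑ t ∈ range L, ∑ s ∈ range L, F (a + s) (a + t)

/-- shifting a 1-D sum by one unit when the end values vanish: `Σ_{s≤N} φ(a+s) = Σ_{s≤N} φ(a+s+1)` if `φ(a) = 0 = φ(a+1+N)`. [folklore] -/
theorem sum_shift {M : Type*} [AddCommMonoid M] (φ : ℤ → M) (a : ℤ) (N : ℕ) (h0 : φ a = 0) (hN : φ (a + 1 + N) = 0) :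
    ∑ s ∈ range (N + 1), φ (a + s) = ∑ s ∈ range (N + 1), φ (a + s + 1) := by
  rw [sum_range_succ', sum_range_succ]
  have e1 : ∀ s : ℕ, a + ((s + 1 : ℕ) : ℤ) = a + s + 1 := fun s => by push_cast; ring
  have e2 : a + (N : ℤ) + 1 = a + 1 + N := by ring
  simp only [e1, Nat.cast_zero, add_zero, h0, e2, hN]

/-- shifting a box sum in the first coordinate. [folklore] -/
theorem box_shift₁ {M : Type*} [AddCommMonoid M] (F : ℤ → ℤ → M) (a : ℤ) (N : ℕ)
    (h0 : ∀ j, F a j = 0) (hN : ∀ j, F (a + 1 + N) j = 0) :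
    boxSum F a (N + 1) = boxSum (fun i j => F (i + 1) j) a (N + 1) := by
  unfold boxSum
  exact sum_congr rfl fun t _ => sum_shift (fun i => F i (a + t)) a N (h0 _) (hN _)

/-- shifting a box sum in the second coordinate. [folklore] -/
theorem box_shift₂ {M : Type*} [AddCommMonoid M] (F : ℤ → ℤ → M) (a : ℤ) (N : ℕ)
    (h0 : ∀ i, F i a = 0) (hN : ∀ i, F i (a + 1 + N) = 0) :
    boxSum F a (N + 1) = boxSum (fun i j => F i (j + 1)) a (N + 1) := by
  unfold boxSum
  refine sum_shift (fun j => ∑ s ∈ range (N + 1), F (a + s) j) a N ?_ ?_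
  · exact sum_eq_zero fun s _ => h0 _
  · exact sum_eq_zero fun s _ => hN _

/-- `boxSum` is additive. [folklore] -/
theorem boxSum_add {M : Type*} [AddCommMonoid M] (F G : ℤ → ℤ → M) (a : ℤ) (L : ℕ) :
    boxSum (fun i j => F i j + G i j) a L = boxSum F a L + boxSum G a L := by
  unfold boxSum
  simp only [sum_add_distrib]

/-- `boxSum` is subtractive. [folklore] -/
theorem boxSum_sub {M : Type*} [AddCommGroup M] (F G : ℤ → ℤ → M) (a : ℤ) (L : ℕ) :
    boxSum (fun i j => F i j - G i j) a L = boxSum F a L - boxSum G a L := by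
  unfold boxSum
  simp only [sum_sub_distrib]

/-- `boxSum` respects pointwise equality. [folklore] -/
theorem boxSum_congr {M : Type*} [AddCommMonoid M] {F G : ℤ → ℤ → M} (h : ∀ i j, F i j = G i j) (a : ℤ) (L : ℕ) :
    boxSum F a L = boxSum G a L := by
  unfold boxSum
  exact sum_congr rfl fun t _ => sum_congr rfl fun s _ => h _ _

/-! ## §2 The cross term is a sum of squares -/

/-- **THE CROSS TERM**: `Σ_box conj(∂₁²z)·(∂₂²z) = Σ_box |m z|²` for `z` supported well inside the box `[a, a+N+1)²` (vanishing outside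
`[a+2, a+N−1)²`, two layers of margin; two summations by parts). [folklore] -/
theorem box_cross_eq (a : ℤ) (N : ℕ)
    (hz : ∀ i j : ℤ, (i < a + 2 ∨ a + N - 1 ≤ i ∨ j < a + 2 ∨ a + N - 1 ≤ j) → z i j = 0) :
    boxSum (fun i j => conj (d1 z i j) * d2 z i j) a (N + 1)
      = boxSum (fun i j => (((‖dmix z i j‖ ^ 2 : ℝ)) : ℂ)) a (N + 1) := by
  -- forward difference in direction 1
  set A : ℤ → ℤ → ℂ := fun i j => z (i + 1) j - z i j with hA
  -- step 1: `conj(d1 z)·d2 z = conj(A)·d2 z − conj(A(·−1))·d2 z`, and shift the second part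
  have h1 : boxSum (fun i j => conj (d1 z i j) * d2 z i j) a (N + 1)
      = boxSum (fun i j => conj (A i j) * d2 z i j) a (N + 1) - boxSum (fun i j => conj (A (i - 1) j) * d2 z i j) a (N + 1) := by
    rw [← boxSum_sub]
    refine boxSum_congr (fun i j => ?_) a (N + 1)
    simp only [hA, d1, map_sub, map_add, map_mul, map_ofNat]
    ring
  have h2 : boxSum (fun i j => conj (A (i - 1) j) * d2 z i j) a (N + 1) = boxSum (fun i j => conj (A i j) * d2 z (i + 1) j) a (N + 1) := by
    rw [box_shift₁ (fun i j => conj (A (i - 1) j) * d2 z i j) a N]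
    · refine boxSum_congr (fun i j => ?_) a (N + 1)
      simp only [add_sub_cancel_right]
    · intro j
      simp only [hA]
      rw [hz (a - 1 + 1) j (Or.inl (by linarith)), hz (a - 1) j (Or.inl (by linarith)), sub_self, map_zero, zero_mul]
    · intro j
      simp only [hA]
      rw [hz (a + 1 + N - 1 + 1) j (Or.inr (Or.inl (by linarith))), hz (a + 1 + N - 1) j (Or.inr (Or.inl (by linarith))), sub_self,
        map_zero, zero_mul]
  -- `d2 z (i+1) j − d2 z i j = d2 A i j = E i j − E i (j−1)` with `E = dmix z`
  have h3 : boxSum (fun i j => conj (d1 z i j) * d2 z i j) a (N + 1)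
      = -(boxSum (fun i j => conj (A i j) * dmix z i j) a (N + 1) - boxSum (fun i j => conj (A i j) * dmix z i (j - 1)) a (N + 1)) := by
    rw [h1, h2, ← boxSum_sub, ← boxSum_sub]
    rw [show -(boxSum (fun i j => conj (A i j) * dmix z i j - conj (A i j) * dmix z i (j - 1)) a (N + 1))
        = boxSum (fun i j => -(conj (A i j) * dmix z i j - conj (A i j) * dmix z i (j - 1))) a (N + 1) by
          unfold boxSum; simp only [sum_neg_distrib]]
    refine boxSum_congr (fun i j => ?_) a (N + 1)
    simp only [hA, d2, dmix, sub_add_cancel]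
    ring
  -- shift the second part in direction 2
  have h4 : boxSum (fun i j => conj (A i j) * dmix z i (j - 1)) a (N + 1) = boxSum (fun i j => conj (A i (j + 1)) * dmix z i j) a (N + 1) := by
    rw [box_shift₂ (fun i j => conj (A i j) * dmix z i (j - 1)) a N]
    · refine boxSum_congr (fun i j => ?_) a (N + 1)
      simp only [add_sub_cancel_right]
    · intro i
      simp only [hA]
      rw [hz (i + 1) a (Or.inr (Or.inr (Or.inl (by linarith)))), hz i a (Or.inr (Or.inr (Or.inl (by linarith)))), sub_self,
        map_zero, zero_mul]
    · intro i
      simp only [hA]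
      rw [hz (i + 1) (a + 1 + N) (Or.inr (Or.inr (Or.inr (by linarith)))), hz i (a + 1 + N) (Or.inr (Or.inr (Or.inr (by linarith)))),
        sub_self, map_zero, zero_mul]
  rw [h3, h4, ← boxSum_sub]
  rw [show -(boxSum (fun i j => conj (A i j) * dmix z i j - conj (A i (j + 1)) * dmix z i j) a (N + 1))
      = boxSum (fun i j => -(conj (A i j) * dmix z i j - conj (A i (j + 1)) * dmix z i j)) a (N + 1) by
        unfold boxSum; simp only [sum_neg_distrib]]
  refine boxSum_congr (fun i j => ?_) a (N + 1)
  push_cast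
  rw [← Complex.conj_mul']
  simp only [hA, dmix, map_sub, map_add]
  ring

/-- **THE BOX `H²` INEQUALITY**: `Σ_box (|∂₁²z|² + |∂₂²z|²) ≤ Σ_box |Δz|²` for `z` supported well inside the box. [folklore] -/
theorem box_hessian_le (a : ℤ) (N : ℕ)
    (hz : ∀ i j : ℤ, (i < a + 2 ∨ a + N - 1 ≤ i ∨ j < a + 2 ∨ a + N - 1 ≤ j) → z i j = 0) :
    boxSum (fun i j => ‖d1 z i j‖ ^ 2 + ‖d2 z i j‖ ^ 2) a (N + 1) ≤ boxSum (fun i j => ‖lap z i j‖ ^ 2) a (N + 1) := by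
  -- `|Δz|² = |d1|² + |d2|² + 2Re(conj(d1) d2)` pointwise
  have hpt : ∀ i j, ‖lap z i j‖ ^ 2 = (‖d1 z i j‖ ^ 2 + ‖d2 z i j‖ ^ 2) + 2 * (conj (d1 z i j) * d2 z i j).re := by
    intro i j
    rw [lap_eq_neg, norm_neg, Complex.sq_norm, Complex.sq_norm, Complex.sq_norm, Complex.normSq_add]
    congr 1
    rw [← Complex.conj_conj (d1 z i j * conj (d2 z i j)), map_mul, Complex.conj_conj, Complex.conj_re]
  have hsum : boxSum (fun i j => ‖lap z i j‖ ^ 2) a (N + 1)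
      = boxSum (fun i j => ‖d1 z i j‖ ^ 2 + ‖d2 z i j‖ ^ 2) a (N + 1) + 2 * (boxSum (fun i j => conj (d1 z i j) * d2 z i j) a (N + 1)).re := by
    rw [boxSum_congr hpt, boxSum_add]
    congr 1
    unfold boxSum
    rw [Complex.re_sum, mul_sum]
    refine sum_congr rfl fun t _ => ?_
    rw [Complex.re_sum, mul_sum]
  have hcross : 0 ≤ (boxSum (fun i j => conj (d1 z i j) * d2 z i j) a (N + 1)).re := by
    rw [box_cross_eq z a N hz]
    unfold boxSum
    rw [Complex.re_sum]
    refine sum_nonneg fun t _ => ?_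
    rw [Complex.re_sum]
    refine sum_nonneg fun s _ => ?_
    rw [Complex.ofReal_re]
    exact sq_nonneg _
  rw [hsum]
  linarith

/-! ## §3 Off the quadrant -/

/-- the indicator of the complement of the quadrant `Q = {0 ≤ i} × {0 ≤ j}`. [folklore] -/
def offQ (i j : ℤ) : ℝ := if 0 ≤ i ∧ 0 ≤ j then 0 else 1

/-- `offQ ∈ {0,1}`, so `offQ·x ≤ x` for `x ≥ 0` and `0 ≤ offQ·x`. [folklore] -/
theorem offQ_nonneg (i j : ℤ) : 0 ≤ offQ i j := by
  unfold offQ; split_ifs <;> norm_num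

/-- `offQ ≤ 1`. [folklore] -/
theorem offQ_le_one (i j : ℤ) : offQ i j ≤ 1 := by
  unfold offQ; split_ifs <;> norm_num

/-- at a quadrant site both sides agree: for `z = 0` on `Q` and `z(−1,0) = 0`, if `0 ≤ i, 0 ≤ j` then
`|∂₁²z(i,j)|² + |∂₂²z(i,j)|² = |Δz(i,j)|²`. [folklore] -/
theorem quadrant_site_eq (hQ : ∀ i j : ℤ, 0 ≤ i → 0 ≤ j → z i j = 0) (hc : z (-1) 0 = 0) {i j : ℤ} (hi : 0 ≤ i) (hj : 0 ≤ j) :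
    ‖d1 z i j‖ ^ 2 + ‖d2 z i j‖ ^ 2 = ‖lap z i j‖ ^ 2 := by
  rw [lap_eq_neg, norm_neg, d1, d2, hQ i j hi hj, hQ (i + 1) j (by linarith) hj, hQ i (j + 1) hi (by linarith)]
  simp only [mul_zero, sub_zero, zero_add]
  rcases le_or_gt 1 i with h1 | h1
  · rw [hQ (i - 1) j (by linarith) hj]; simp
  rcases le_or_gt 1 j with h2 | h2
  · rw [hQ i (j - 1) hi (by linarith)]; simp
  · have ei : i = 0 := by omega
    have ej : j = 0 := by omega
    subst ei; subst ej
    norm_num [hc]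

/-- **THE `H²` INEQUALITY OFF THE QUADRANT** (leaf L10, model coordinates): for `z` supported well inside the box, vanishing on the quadrant and
at `(−1,0)`:  `Σ_{box} offQ·(|∂₁²z|² + |∂₂²z|²) ≤ Σ_{box} offQ·|Δz|²`. [folklore] -/
theorem hessian_le_offQuadrant (a : ℤ) (N : ℕ)
    (hz : ∀ i j : ℤ, (i < a + 2 ∨ a + N - 1 ≤ i ∨ j < a + 2 ∨ a + N - 1 ≤ j) → z i j = 0)
    (hQ : ∀ i j : ℤ, 0 ≤ i → 0 ≤ j → z i j = 0) (hc : z (-1) 0 = 0) :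
    boxSum (fun i j => offQ i j * (‖d1 z i j‖ ^ 2 + ‖d2 z i j‖ ^ 2)) a (N + 1)
      ≤ boxSum (fun i j => offQ i j * ‖lap z i j‖ ^ 2) a (N + 1) := by
  -- `offQ·f = f − onQ·f` and on `Q` the two integrands agree
  have hsplit : ∀ i j, offQ i j * (‖d1 z i j‖ ^ 2 + ‖d2 z i j‖ ^ 2) - offQ i j * ‖lap z i j‖ ^ 2
      = (‖d1 z i j‖ ^ 2 + ‖d2 z i j‖ ^ 2) - ‖lap z i j‖ ^ 2 := by
    intro i j
    unfold offQ
    split_ifs with h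
    · rw [quadrant_site_eq z hQ hc h.1 h.2]; ring
    · ring
  have hglob := box_hessian_le z a N hz
  have hdiff : boxSum (fun i j => offQ i j * (‖d1 z i j‖ ^ 2 + ‖d2 z i j‖ ^ 2)) a (N + 1)
      - boxSum (fun i j => offQ i j * ‖lap z i j‖ ^ 2) a (N + 1)
      = boxSum (fun i j => ‖d1 z i j‖ ^ 2 + ‖d2 z i j‖ ^ 2) a (N + 1) - boxSum (fun i j => ‖lap z i j‖ ^ 2) a (N + 1) := by
    rw [← boxSum_sub, ← boxSum_sub]
    exact boxSum_congr hsplit a (N + 1)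
  linarith [hdiff]

end Summit.QuantumFields.BalabanUV.Beta.GAN24.DirichletRingHessianIdentity

end
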